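import Summits.QuantumAdvantage.QuantumAdvantage.Theses.SymplecticPurity
import Summits.QuantumAdvantage.QuantumAdvantage.Theses.Dequantize
import Summits.QuantumAdvantage.QuantumAdvantage.Theorems.SymplecticPurityGoldDefs
import Literature.Barriers.QuantumAdvantage.BoundedEntanglementLocality
import Literature.Computability.Complexity.LengthCompare
import Literature.Computability.Complexity.ProbabilisticClassesProofs
import Literature.Computability.Cryptography.QuantumCircuitProofs

/-!
# Line `Sketch` (idea `local-flatness-lu-frames`) for the crux `DeqThesis` (stmt-QuantumAdvantage-0242)

Lead's skeleton, **v4 (continuation lead c1, 2026-08-16): the kill's witness family is RESHAPED** from the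
scratch-free cube family (`cubeFamily`, state `2^{-n/2}Σ_y |y⟩|y³⟩`) to the TWO-GOLD-MAP family
(`goldFamily`, state `2^{-n/2}Σ_y |y⟩|y³⟩|y⁵⟩`, `n + n` ancillas; Defs file
`Theorems/SymplecticPurityGoldDefs.lean`, p99465, ACCEPTED commit 6acdbb9b5838).

THE CRUX. `X = DeqThesis = FFThesis = (BQP ⊆ BPP)`, consensus-FALSE; `¬X ↔ QuantumAdvantage` verbatim
(`Theorems/DeqThesis/Negative/DeqThesisKillIsSummit.lean`). No line closes 0242. Every admissible line is
a ROAD `C⁺ → X` whose load-bearing stub is designed false, plus the KILL `¬C⁺`; this file registers both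
halves as stubs so that the kill side can be worked and landed (`--supports`) by stub workers.

THE ROAD (stubs `stub_road`, `stub_finder`; glue `ffThesis_of_uniformGapFP` PROVED here) — unchanged
from v1–v3. `stub_road` = H_LFF, the LU-DRESSED free-frame hypothesis: every uniform oracle-free
Clifford+T family has, at every input and stage, an LU-dressed Clifford frame `U ∘ (⊗ᵢ uᵢ)` in which EVERY
linear cut has purity `≥ 1/poly`. `stub_finder` = the representational → algorithmic edge. Glue:
gap-separability in `FP` of every uniform family gives `BQP ⊆ P ⊆ BPP` — PROVED, so
`DeqThesis_of stub_road stub_finder : DeqThesis` is kernel-checked modulo the two road stubs.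

THE KILL, v4 (stubs `stub_killComposeGen`, `stub_goldUniform`, `stub_goldState`, `stub_goldBridge`,
`stub_goldFlat`; glue `not_road_of` PROVED here). WHY THE RESHAPE. v1–v3 (lead c0) proved flatness of the
cube graph state against every locally rotated Pauli string EXCEPT the doubly-balanced, non-H-like core
(`stub_coreBalancedFlat`): there the absolute-value pairing bound is exactly borderline (`O(1)`), and the
remaining decay needs square-root cancellation in `ℤ₈`-twisted Gold sums (T-type tests), outside every
known Weil/Galois-ring range (Lines/Sketch.md §3b). The continuation lead's observation: with a SECOND
Gold map the absolute-value bound itself decays, for ALL tilts, with no character expansion of phases: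
against `A ⊗ B¹ ⊗ B²`, pair `x' = x ⊕ d`; `|A(x, x⊕d)| = w(d)` with `Σ_d w(d)² = 1`; for `d ≠ 0` the value
differences `D_d(x³) = dx²+d²x+d³` and `D_d(x⁵) = dx⁴+d⁴x+d⁵` are affine in `x` with fibres `≤ 2` and `≤ 4`,
so Cauchy–Schwarz BETWEEN THE TWO VALUE REGISTERS gives
`Σ_x |B¹(·)||B²(·)| ≤ (2 Σ_t w¹(t)²)^{1/2} (4 Σ_t w²(t)²)^{1/2} = 2√2`; the diagonal `d = 0` is a Gold-type
Walsh sum `|Σ_x (−1)^{φ(x) + ψ₁(x³) + ψ₂(x⁵)}| ≤ 4·2^{n/2}` (`abs_walsh_cube_le`, `abs_walsh_gold_add_le`, landed).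
Hence `|⟨ĝ₂|A⊗B¹⊗B²|ĝ₂⟩| ≤ 2^{-n}(4·2^{n/2} + 2√2·2^{n/2}) < 7·2^{-n/2}` — optimal rate, every LU-rotated
Pauli string, every additive coordinatisation `e`, NO CORE (numerics: work/num/gold2_flat.py, n = 4, 5:
all families incl. the T-enemy `≤ 2·2^{-n/2}`). (For ONE Gold map the same estimate is `≤ O(1)`: the
single value register's CS costs `|Im D_d|^{1/2} = 2^{(n-1)/2}`; the graph `(u, φ_d u)` of the second
register is thin and CS costs only the fibre sizes.)
* `stub_killComposeGen` (M, provable now; GENERIC in the family — the landed `stub_killCompose` p87798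
  with `cubeFamily` replaced by a variable `F`, its oracle-freeness/uniformity as hypotheses, and the cut
  `k = ⌊δ|x|⌋ ≤ |x| ≤ |x| + F.ancillas |x|`): family-level local flatness of ANY uniform oracle-free
  family refutes the road.
* `stub_goldUniform` (M, provable now; clone of `SymplecticPurityNoFreeFrameUniform.lean` with the extra
  program `pentOpsA`): `goldFamily` is oracle-free and polynomial-time uniform.
* `stub_goldState` (M+M, provable now; clones of `…NoFreeFrameFamily.lean` and `…NoFreeFrameCoord.lean`):
  (a) on `0ⁿ`, `n ≥ 1`, the final state of `goldFamily` is the normalised graph state of `goldMap n`;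
  (b) for `n = 2·3^k`, `goldMap n y = (coords of (e⁻¹y)³) ++ (coords of (e⁻¹y)⁵)` in the power basis
  `e = cubeEquiv k` (`(Σcᵢαⁱ)⁵ = Σ_{i,j} cᵢcⱼ α^{i+4j}` by Frobenius; XOR-network parity as in `cubeMap_eq_cube`).
* `stub_goldBridge` (M, provable now from (a), (b) as HYPOTHESES; clone of `…DeqThesisBridge.lean`): the
  field-level flatness of `2^{-n/2}Σ|x⟩|x³⟩|x⁵⟩` (all `K`, `|K| = 2ⁿ`, all additive `e`) gives the
  family-level flatness of `goldFamily` (inputs `0^{2·3^k}`, final stage).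
* `stub_goldFlat` (M/L, provable now; lead): the field-level flatness theorem above (pairing lemma with CS
  between the two value registers; differential fibres of `x³`, `x⁵`; trace representation of additive
  functionals + `abs_walsh_gold_add_le` / `abs_walsh_cube_le` on the diagonal; `δ := 1/4`).
Glue: `not_road_of : stub_goldUniform → stub_goldState → stub_goldBridge → stub_goldFlat →
stub_killComposeGen → ¬ stub_road` — PROVED here. The v3 cube-family stubs (`stub_lightFlat`,
`stub_oneSidedFlat`, `stub_unbalancedFlat`, `stub_hlikeFlat` — all LANDED — and the open
`stub_coreBalancedFlat`) leave the skeleton; what they proved stays in the tree as theorems about the cube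
state (`Theorems/SymplecticPurityDeqThesis*.lean`, kill-modulo-core `roadLFF_false_of_coreBalancedFlat3`).

DISPROOF USED (`Cruxes/DeqThesis/Disproof.lean` v1.3 + landed `Theorems/DeqThesis/Negative/*`):
`deqThesis_false_without_uniformity` / `_without_gap` — the road and the readout are typed over
`IsUniform` families and the `2/3`–`1/3` gap, never the refuted non-uniform or gapless strengthenings;
`not_ffThesis_iff_quantumAdvantage` — the composition is not staffed beyond the glue, the line's product is
the kill; §5 Targets: none aimed at v4 stubs yet.

All statements below use ONLY tree vocabulary (incl. the route-posited `goldFamily` objects of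
`Theorems/SymplecticPurityGoldDefs.lean`, landed p99465), so every registered stub can be proved in a
stand-alone `Theorems/` helper file. `sorry` occurs only inside `stub_*`.
-/

set_option linter.dupNamespace false

noncomputable section

namespace Summit.QuantumAdvantage.QuantumAdvantage.Cruxes.DeqThesis.Lines.Sketch

open Matrix Finset
open Literature.Computability.Complexity Literature.Computability.Complexity.Classes
open Literature.Computability.QuantumComplexity Literature.Computability.Cryptography
open Literature.Barriers.QuantumAdvantage
open Summit.QuantumAdvantage.QuantumAdvantage.Theses.SymplecticPurity (FFThesis)
open Summit.QuantumAdvantage.QuantumAdvantage.Theses.Dequantize (DeqThesis)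
open Summit.QuantumAdvantage.QuantumAdvantage.Theorems.SymplecticPurity

/-! ### Named statements (documentation; the stubs restate them with everything unfolded) -/

/-- **H_LFF, the LU-dressed free-frame road** (representational, purity form; `NoFreeFrame`'s
antecedent with a layer of single-qubit unitaries under the Clifford frame). -/
def RoadLFF : Prop :=
  ∀ F : QCircuitFamily cliffordT, F.IsOracleFree → F.IsUniform → ∃ c : ℕ, ∀ x : List Bool, ∀ j : ℕ,
    ∃ u : Fin (x.length + F.ancillas x.length) → Matrix Bool Bool ℂ,
      (∀ i, u i ∈ Matrix.unitaryGroup Bool ℂ) ∧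
      ∃ U : Matrix (QReg (x.length + F.ancillas x.length)) (QReg (x.length + F.ancillas x.length)) ℂ,
        U ∈ Matrix.unitaryGroup (QReg (x.length + F.ancillas x.length)) ℂ ∧
        (∀ S : Fin (x.length + F.ancillas x.length) → Pauli,
          ∃ S' : Fin (x.length + F.ancillas x.length) → Pauli, ∃ c' : ℂ, ‖c'‖ = 1 ∧
            U * pauliString S * star U = c' • pauliString S') ∧
        ∀ k ≤ x.length + F.ancillas x.length,
          (1 : ℝ) / (x.length ^ c + c) ≤ ‖puritySum k (U.mulVec ((tensorAll u).mulVec (F.stateAfter x j)))‖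

/-- **Uniform gap-separability in `FP`**: for every uniform oracle-free Clifford+T family some
polynomial-time string function outputs `[1]` above the `2/3` threshold and `[0]` below `1/3`. This is
the algorithmic endpoint of every frame road (frames found and contracted in polynomial time, the
one-wire expectation read off and compared with `1/2`). -/
def UniformGapFP : Prop :=
  ∀ F : QCircuitFamily cliffordT, F.IsOracleFree → F.IsUniform → ∃ g ∈ FP, ∀ x : List Bool,
    ((2 : ℝ) / 3 ≤ F.acceptProbOn 0 x → g x = [true]) ∧ (F.acceptProbOn 0 x ≤ 1 / 3 → g x = [false])

/-- **Family-level local flatness** of a circuit family `F`: at rate `2^{-δ|x|}`, on inputs of unbounded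
length, some stage of `F` on `x` is flat against every LOCALLY ROTATED Pauli string `⊗ᵢ uᵢ σ_{Sᵢ} uᵢ†`
(`S ≠ I`). -/
def FamilyLocallyFlatOf (F : QCircuitFamily cliffordT) : Prop :=
  ∃ δ : ℝ, 0 < δ ∧ ∀ n₀ : ℕ, ∃ x : List Bool, n₀ ≤ x.length ∧ ∃ j : ℕ,
    ∀ u : Fin (x.length + F.ancillas x.length) → Matrix Bool Bool ℂ,
      (∀ i, u i ∈ Matrix.unitaryGroup Bool ℂ) →
      ∀ S : Fin (x.length + F.ancillas x.length) → Pauli, S ≠ (fun _ => Pauli.I) →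
        ‖star (F.stateAfter x j) ⬝ᵥ
            (tensorAll (fun i => u i * (S i).mat * star (u i))).mulVec (F.stateAfter x j)‖
          ≤ (2 : ℝ) ^ (-(δ * (x.length : ℝ)))

/-- **`GoldLocallyFlat'`** (field level): the normalised two-Gold-map graph state
`2^{-n/2} Σ_x |x⟩|e((e⁻¹x)³)⟩|e((e⁻¹x)⁵)⟩` on `n + (n + n)` wires is `2^{-δn}`-flat against every locally
rotated non-identity Pauli string, for all fields of order `2ⁿ`, `n ≥ n₀`, and all additive
identifications `e`. -/
def GoldLocallyFlat' : Prop :=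
  ∃ δ : ℝ, 0 < δ ∧ ∃ n₀ : ℕ, ∀ n ≥ n₀, ∀ (K : Type) [Field K] [Fintype K], Fintype.card K = 2 ^ n →
    ∀ e : K ≃+ (Fin n → ZMod 2),
    ∀ u : Fin (n + (n + n)) → Matrix Bool Bool ℂ, (∀ i, u i ∈ Matrix.unitaryGroup Bool ℂ) →
      ∀ S : Fin (n + (n + n)) → Pauli, S ≠ (fun _ => Pauli.I) →
        ‖star (fun w : QReg (n + (n + n)) =>
              if (fun j : Fin (n + n) => w (Fin.natAdd n j)) =
                  Fin.append
                    (fun l : Fin n => decide (e ((e.symm (fun i : Fin n => if w (Fin.castAdd (n + n) i) then 1 else 0)) ^ 3) l = 1))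
                    (fun l : Fin n => decide (e ((e.symm (fun i : Fin n => if w (Fin.castAdd (n + n) i) then 1 else 0)) ^ 5) l = 1))
              then ((Real.sqrt 2 ^ n)⁻¹ : ℂ) else 0) ⬝ᵥ
            (tensorAll (fun i => u i * (S i).mat * star (u i))).mulVec
              (fun w : QReg (n + (n + n)) =>
              if (fun j : Fin (n + n) => w (Fin.natAdd n j)) =
                  Fin.append
                    (fun l : Fin n => decide (e ((e.symm (fun i : Fin n => if w (Fin.castAdd (n + n) i) then 1 else 0)) ^ 3) l = 1))
                    (fun l : Fin n => decide (e ((e.symm (fun i : Fin n => if w (Fin.castAdd (n + n) i) then 1 else 0)) ^ 5) l = 1))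
              then ((Real.sqrt 2 ^ n)⁻¹ : ℂ) else 0)‖
          ≤ (2 : ℝ) ^ (-(δ * (n : ℝ)))

/-- **`GoldStateAfter`**: on the all-zero input of length `n ≥ 1` the final state of `goldFamily` is the
normalised graph state of `goldMap n` (amplitude `2^{-n/2}` on `|y⟩|goldMap n y⟩`, `0` elsewhere). -/
def GoldStateAfter : Prop :=
  ∀ x : List Bool, (∀ i, x.get i = false) → 0 < x.length →
      goldFamily.stateAfter x (goldGates x.length).length =
        fun z : QReg (x.length + (x.length + x.length)) =>
          if (fun j : Fin (x.length + x.length) => z (Fin.natAdd x.length j)) =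
              goldMap x.length (fun i : Fin x.length => z (Fin.castAdd (x.length + x.length) i))
          then invSqrt2 ^ x.length else 0

/-- **`GoldMapEq`**: for `n = 2·3^k` the program's map is the pair of Gold maps of
`𝔽₂[X]/(Φ_{3^{k+1}})` in power-basis coordinates: `goldMap n y = [(e⁻¹y)³] ++ [(e⁻¹y)⁵]`. -/
def GoldMapEq : Prop :=
  ∀ (k : ℕ) (y : Fin (2 * 3 ^ k) → Bool),
      goldMap (2 * 3 ^ k) y =
        Fin.append
          (fun l : Fin (2 * 3 ^ k) => decide (cubeEquiv k (((cubeEquiv k).symm fun i => if y i then 1 else 0) ^ 3) l = 1))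
          (fun l : Fin (2 * 3 ^ k) => decide (cubeEquiv k (((cubeEquiv k).symm fun i => if y i then 1 else 0) ^ 5) l = 1))

/-! ### Kernel-checked algebra of local layers (from the ideator's Sketch; reusable verbatim) -/

section tensorAlgebra
variable {ι : Type*} [Fintype ι] [DecidableEq ι]

/-- `tensorAll` is multiplicative. [folklore] -/
theorem tensorAll_mul (A B : ι → Matrix Bool Bool ℂ) :
    tensorAll A * tensorAll B = tensorAll (fun i => A i * B i) := by
  ext x y
  simp only [Matrix.mul_apply, tensorAll_apply]
  rw [Finset.prod_univ_sum]
  simp only [Fintype.piFinset_univ]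
  refine Finset.sum_congr rfl fun z _ => ?_
  rw [Finset.prod_mul_distrib]

omit [DecidableEq ι] in
/-- `tensorAll` commutes with the conjugate transpose. [folklore] -/
theorem conjTranspose_tensorAll (A : ι → Matrix Bool Bool ℂ) :
    (tensorAll A)ᴴ = tensorAll (fun i => (A i)ᴴ) := by
  ext x y
  simp only [Matrix.conjTranspose_apply, tensorAll_apply, star_prod]

/-- `⟨Mψ| P |Mψ⟩ = ⟨ψ| Mᴴ P M |ψ⟩`. [folklore] -/
theorem star_mulVec_dot (M P : Matrix (ι → Bool) (ι → Bool) ℂ) (ψ : (ι → Bool) → ℂ) :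
    star (M *ᵥ ψ) ⬝ᵥ (P *ᵥ (M *ᵥ ψ)) = star ψ ⬝ᵥ ((Mᴴ * P * M) *ᵥ ψ) := by
  rw [Matrix.star_mulVec, ← Matrix.dotProduct_mulVec, Matrix.mulVec_mulVec, Matrix.mulVec_mulVec]

omit [DecidableEq ι] in
/-- `tensorAll 1 = 1`. [folklore] -/
theorem tensorAll_one : tensorAll (fun _ : ι => (1 : Matrix Bool Bool ℂ)) = 1 := by
  ext x y
  simp only [tensorAll_apply, Matrix.one_apply]
  by_cases h : x = y
  · subst h; simp
  · obtain ⟨i, hi⟩ := Function.ne_iff.mp h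
    rw [if_neg h]
    exact Finset.prod_eq_zero (Finset.mem_univ i) (by simp [hi])

/-- A layer of single-qubit unitaries is unitary (`Uᴴ U = 1`). [folklore] -/
theorem tensorAll_unitary (u : ι → Matrix Bool Bool ℂ)
    (hu : ∀ i, u i ∈ Matrix.unitaryGroup Bool ℂ) : (tensorAll u)ᴴ * tensorAll u = 1 := by
  rw [conjTranspose_tensorAll, tensorAll_mul]
  have : (fun i => (u i)ᴴ * u i) = fun _ => (1 : Matrix Bool Bool ℂ) := by
    funext i
    have h := hu i
    rw [Matrix.mem_unitaryGroup_iff'] at h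
    simpa [Matrix.star_eq_conjTranspose] using h
  rw [this, tensorAll_one]

/-- A layer of single-qubit unitaries is in the unitary group of the register. [folklore] -/
theorem tensorAll_mem_unitaryGroup (u : ι → Matrix Bool Bool ℂ)
    (hu : ∀ i, u i ∈ Matrix.unitaryGroup Bool ℂ) :
    tensorAll u ∈ Matrix.unitaryGroup (ι → Bool) ℂ := by
  rw [Matrix.mem_unitaryGroup_iff', Matrix.star_eq_conjTranspose]
  exact tensorAll_unitary u hu

/-- **LU reduction**: `⟨(⊗u)ψ| σ_S |(⊗u)ψ⟩ = ⟨ψ| ⊗ᵢ (uᵢ† σ_{Sᵢ} uᵢ) |ψ⟩` — a local unitary layer moves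
from the state to the test. [folklore] -/
theorem luReduction' (u : ι → Matrix Bool Bool ℂ) (S : ι → Pauli) (ψ : (ι → Bool) → ℂ) :
    star ((tensorAll u) *ᵥ ψ) ⬝ᵥ ((pauliString S) *ᵥ ((tensorAll u) *ᵥ ψ)) =
      star ψ ⬝ᵥ ((tensorAll (fun i => star (u i) * (S i).mat * star (star (u i)))) *ᵥ ψ) := by
  rw [star_mulVec_dot, pauliString_eq, conjTranspose_tensorAll, tensorAll_mul, tensorAll_mul]
  simp only [Matrix.star_eq_conjTranspose, Matrix.conjTranspose_conjTranspose]

end tensorAlgebra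

/-! ### The registered stubs

`stub_*` theorems carry the `sorry`s; `Registered.stub_*` are the name-keyed aliases used as the
hypotheses of `DeqThesis_of` / `not_road_of`. -/

/-- **Stub R1 · `stub_road`** (DESIGNED FALSE — the kill target; nobody proves it): the LU-dressed
free-frame road `RoadLFF`, fully unfolded. -/
theorem stub_road :
    ∀ F : QCircuitFamily cliffordT, F.IsOracleFree → F.IsUniform → ∃ c : ℕ, ∀ x : List Bool, ∀ j : ℕ,
    ∃ u : Fin (x.length + F.ancillas x.length) → Matrix Bool Bool ℂ,
      (∀ i, u i ∈ Matrix.unitaryGroup Bool ℂ) ∧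
      ∃ U : Matrix (QReg (x.length + F.ancillas x.length)) (QReg (x.length + F.ancillas x.length)) ℂ,
        U ∈ Matrix.unitaryGroup (QReg (x.length + F.ancillas x.length)) ℂ ∧
        (∀ S : Fin (x.length + F.ancillas x.length) → Pauli,
          ∃ S' : Fin (x.length + F.ancillas x.length) → Pauli, ∃ c' : ℂ, ‖c'‖ = 1 ∧
            U * pauliString S * star U = c' • pauliString S') ∧
        ∀ k ≤ x.length + F.ancillas x.length,
          (1 : ℝ) / (x.length ^ c + c) ≤
            ‖puritySum k (U.mulVec ((tensorAll u).mulVec (F.stateAfter x j)))‖ := by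
  sorry

/-- **Stub R2 · `stub_finder`** (the representational → algorithmic edge of the road; unstaffed this
round): from H_LFF, the `2/3`–`1/3` gap of every uniform oracle-free Clifford+T family is separated by an
`FP` function (dressed frames FOUND and CONTRACTED in polynomial time: `Z₀` pulled through `⊗u` is 3
Paulis, through the Clifford `U` three Pauli strings, each an MPS transfer-matrix contraction). -/
theorem stub_finder :
    (∀ F : QCircuitFamily cliffordT, F.IsOracleFree → F.IsUniform → ∃ c : ℕ, ∀ x : List Bool, ∀ j : ℕ,
      ∃ u : Fin (x.length + F.ancillas x.length) → Matrix Bool Bool ℂ,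
        (∀ i, u i ∈ Matrix.unitaryGroup Bool ℂ) ∧
        ∃ U : Matrix (QReg (x.length + F.ancillas x.length)) (QReg (x.length + F.ancillas x.length)) ℂ,
          U ∈ Matrix.unitaryGroup (QReg (x.length + F.ancillas x.length)) ℂ ∧
          (∀ S : Fin (x.length + F.ancillas x.length) → Pauli,
            ∃ S' : Fin (x.length + F.ancillas x.length) → Pauli, ∃ c' : ℂ, ‖c'‖ = 1 ∧
              U * pauliString S * star U = c' • pauliString S') ∧
          ∀ k ≤ x.length + F.ancillas x.length,
            (1 : ℝ) / (x.length ^ c + c) ≤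
              ‖puritySum k (U.mulVec ((tensorAll u).mulVec (F.stateAfter x j)))‖) →
    ∀ F : QCircuitFamily cliffordT, F.IsOracleFree → F.IsUniform → ∃ g ∈ FP, ∀ x : List Bool,
      ((2 : ℝ) / 3 ≤ F.acceptProbOn 0 x → g x = [true]) ∧ (F.acceptProbOn 0 x ≤ 1 / 3 → g x = [false]) := by
  sorry

/-- **Stub K1 · `stub_killComposeGen`** (M, provable now; GENERIC form of the landed `stub_killCompose`,
p87798 `Theorems/SymplecticPurityDeqThesisKillCompose.lean`): family-level local flatness of ANY oracle-free
uniform Clifford+T family `F` refutes the road. Route: verbatim the landed proof with `cubeFamily ↦ F`,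
`cubeFamily_isOracleFree ↦ hOF`, `cubeFamily_isUniform ↦ hU`, and the cut bound
`k = ⌊δ'|x|⌋ ≤ |x| ≤ |x| + F.ancillas |x|` (`Nat.le_add_right`) in place of `cubeFamily.ancillas n = n`;
reuse `lff_luReduction`, `lff_tensorAll_mem_unitaryGroup`, `lff_eventually_three_mul_lt_pow` by import. -/
theorem stub_killComposeGen :
    ∀ F : QCircuitFamily cliffordT, F.IsOracleFree → F.IsUniform →
    (∃ δ : ℝ, 0 < δ ∧ ∀ n₀ : ℕ, ∃ x : List Bool, n₀ ≤ x.length ∧ ∃ j : ℕ,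
      ∀ u : Fin (x.length + F.ancillas x.length) → Matrix Bool Bool ℂ,
        (∀ i, u i ∈ Matrix.unitaryGroup Bool ℂ) →
        ∀ S : Fin (x.length + F.ancillas x.length) → Pauli, S ≠ (fun _ => Pauli.I) →
          ‖star (F.stateAfter x j) ⬝ᵥ
              (tensorAll (fun i => u i * (S i).mat * star (u i))).mulVec (F.stateAfter x j)‖
            ≤ (2 : ℝ) ^ (-(δ * (x.length : ℝ)))) →
    ¬ (∀ F : QCircuitFamily cliffordT, F.IsOracleFree → F.IsUniform → ∃ c : ℕ, ∀ x : List Bool, ∀ j : ℕ,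
      ∃ u : Fin (x.length + F.ancillas x.length) → Matrix Bool Bool ℂ,
        (∀ i, u i ∈ Matrix.unitaryGroup Bool ℂ) ∧
        ∃ U : Matrix (QReg (x.length + F.ancillas x.length)) (QReg (x.length + F.ancillas x.length)) ℂ,
          U ∈ Matrix.unitaryGroup (QReg (x.length + F.ancillas x.length)) ℂ ∧
          (∀ S : Fin (x.length + F.ancillas x.length) → Pauli,
            ∃ S' : Fin (x.length + F.ancillas x.length) → Pauli, ∃ c' : ℂ, ‖c'‖ = 1 ∧
              U * pauliString S * star U = c' • pauliString S') ∧
          ∀ k ≤ x.length + F.ancillas x.length,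
            (1 : ℝ) / (x.length ^ c + c) ≤
              ‖puritySum k (U.mulVec ((tensorAll u).mulVec (F.stateAfter x j)))‖) := by
  sorry

/-- **Stub K2 · `stub_goldUniform`** (M, provable now; clone of `Theorems/SymplecticPurityNoFreeFrameUniform.lean`):
the two-Gold-map family is oracle-free (`revCompile_isOracleFree`) and polynomial-time uniform — the
program `goldOpsA n = cubeOpsA n ++ pentOpsA n` is in the `CodeFP` algebra (`cubeOpsA_fp` is landed; the
`pent` chunks are `cubeLinChunk_fp`/`cubeQuadChunk_fp` with `3i ↦ 5i`, `i+2j ↦ i+4j`, `n+l ↦ n+n+l`;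
`clopAppend`; wires reduced mod `n + (n + n)`; `sigmaEncode` through `map_toAG_*` exactly as for `cubeGates`). -/
theorem stub_goldUniform : goldFamily.IsOracleFree ∧ goldFamily.IsUniform := by
  sorry

/-- **Stub K3 · `stub_goldState`** (M+M, provable now; clones of `…NoFreeFrameFamily.lean` (a) and of the
main part of `…NoFreeFrameCoord.lean` (b)): (a) `GoldStateAfter` — Hadamard layer
(`hadamards_mulVec_basisState`), classical action of the compiled program (`revCompile_mulVec_basisState`,
`revEval_toRevList`, `RevSim.clEval_map_finOf_apply`), input register untouched (targets `≥ n`);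
(b) `GoldMapEq` — XOR-network parity (`clEval_xor` with controls `< n`, targets `≥ n`; at wire `n + l` only
the `cubeOpsA` gates fire, at wire `n + n + l` only the `pentOpsA` gates), `cubeEquiv_root_pow`, and the
Frobenius expansions `(Σcᵢαⁱ)³ = Σ cᵢcⱼα^{i+2j}` (`cube_expand`, landed) / `(Σcᵢαⁱ)⁵ = Σ cᵢcⱼα^{i+4j}`. -/
theorem stub_goldState :
    (∀ x : List Bool, (∀ i, x.get i = false) → 0 < x.length →
      goldFamily.stateAfter x (goldGates x.length).length =
        fun z : QReg (x.length + (x.length + x.length)) =>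
          if (fun j : Fin (x.length + x.length) => z (Fin.natAdd x.length j)) =
              goldMap x.length (fun i : Fin x.length => z (Fin.castAdd (x.length + x.length) i))
          then invSqrt2 ^ x.length else 0) ∧
    (∀ (k : ℕ) (y : Fin (2 * 3 ^ k) → Bool),
      goldMap (2 * 3 ^ k) y =
        Fin.append
          (fun l : Fin (2 * 3 ^ k) => decide (cubeEquiv k (((cubeEquiv k).symm fun i => if y i then 1 else 0) ^ 3) l = 1))
          (fun l : Fin (2 * 3 ^ k) => decide (cubeEquiv k (((cubeEquiv k).symm fun i => if y i then 1 else 0) ^ 5) l = 1))) := by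
  sorry

/-- **Stub K4 · `stub_goldBridge`** (M, provable now from `GoldStateAfter`, `GoldMapEq` as HYPOTHESES;
clone of `Theorems/SymplecticPurityDeqThesisBridge.lean`, p87072): the field-level `GoldLocallyFlat'`
gives the family-level flatness of `goldFamily`. Route: for the target `n₀'` pick `k` with
`2·3^k ≥ max n₀ n₀' ⊔ 1`, `x := List.replicate (2·3^k) false`, `j := (goldGates x.length).length`;
rewrite the state by (a); identify `goldMap |x|` with the two Gold maps of `AdjoinRoot (cubePoly k)` read
through `cubeEquiv k` by (b), transported along `|x| = 2·3^k` (prove the transport for a VARIABLE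
`m = 2·3^k` by `subst`); `fact_irreducible_cubePoly`, `card_cubeField`, `Fintype.ofFinite`,
`invSqrt2 ^ n = (√2ⁿ)⁻¹` (`invSqrt2_eq_ofReal`); then apply `GoldLocallyFlat'` at `n = |x|`
(`goldFamily.ancillas n = n + n` is `rfl`). -/
theorem stub_goldBridge :
    (∀ x : List Bool, (∀ i, x.get i = false) → 0 < x.length →
      goldFamily.stateAfter x (goldGates x.length).length =
        fun z : QReg (x.length + (x.length + x.length)) =>
          if (fun j : Fin (x.length + x.length) => z (Fin.natAdd x.length j)) =
              goldMap x.length (fun i : Fin x.length => z (Fin.castAdd (x.length + x.length) i))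
          then invSqrt2 ^ x.length else 0) →
    (∀ (k : ℕ) (y : Fin (2 * 3 ^ k) → Bool),
      goldMap (2 * 3 ^ k) y =
        Fin.append
          (fun l : Fin (2 * 3 ^ k) => decide (cubeEquiv k (((cubeEquiv k).symm fun i => if y i then 1 else 0) ^ 3) l = 1))
          (fun l : Fin (2 * 3 ^ k) => decide (cubeEquiv k (((cubeEquiv k).symm fun i => if y i then 1 else 0) ^ 5) l = 1))) →
    (∃ δ : ℝ, 0 < δ ∧ ∃ n₀ : ℕ, ∀ n ≥ n₀, ∀ (K : Type) [Field K] [Fintype K], Fintype.card K = 2 ^ n →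
      ∀ e : K ≃+ (Fin n → ZMod 2),
      ∀ u : Fin (n + (n + n)) → Matrix Bool Bool ℂ, (∀ i, u i ∈ Matrix.unitaryGroup Bool ℂ) →
        ∀ S : Fin (n + (n + n)) → Pauli, S ≠ (fun _ => Pauli.I) →
          ‖star (fun w : QReg (n + (n + n)) =>
                if (fun j : Fin (n + n) => w (Fin.natAdd n j)) =
                    Fin.append
                      (fun l : Fin n => decide (e ((e.symm (fun i : Fin n => if w (Fin.castAdd (n + n) i) then 1 else 0)) ^ 3) l = 1))
                      (fun l : Fin n => decide (e ((e.symm (fun i : Fin n => if w (Fin.castAdd (n + n) i) then 1 else 0)) ^ 5) l = 1))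
                then ((Real.sqrt 2 ^ n)⁻¹ : ℂ) else 0) ⬝ᵥ
              (tensorAll (fun i => u i * (S i).mat * star (u i))).mulVec
                (fun w : QReg (n + (n + n)) =>
                if (fun j : Fin (n + n) => w (Fin.natAdd n j)) =
                    Fin.append
                      (fun l : Fin n => decide (e ((e.symm (fun i : Fin n => if w (Fin.castAdd (n + n) i) then 1 else 0)) ^ 3) l = 1))
                      (fun l : Fin n => decide (e ((e.symm (fun i : Fin n => if w (Fin.castAdd (n + n) i) then 1 else 0)) ^ 5) l = 1))
                then ((Real.sqrt 2 ^ n)⁻¹ : ℂ) else 0)‖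
            ≤ (2 : ℝ) ^ (-(δ * (n : ℝ)))) →
    (∃ δ : ℝ, 0 < δ ∧ ∀ n₀ : ℕ, ∃ x : List Bool, n₀ ≤ x.length ∧ ∃ j : ℕ,
      ∀ u : Fin (x.length + goldFamily.ancillas x.length) → Matrix Bool Bool ℂ,
        (∀ i, u i ∈ Matrix.unitaryGroup Bool ℂ) →
        ∀ S : Fin (x.length + goldFamily.ancillas x.length) → Pauli, S ≠ (fun _ => Pauli.I) →
          ‖star (goldFamily.stateAfter x j) ⬝ᵥ
              (tensorAll (fun i => u i * (S i).mat * star (u i))).mulVec (goldFamily.stateAfter x j)‖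
            ≤ (2 : ℝ) ^ (-(δ * (x.length : ℝ)))) := by
  sorry

/-- **Stub K5 · `stub_goldFlat`** (M/L, provable now; LEAD): `GoldLocallyFlat'` — the normalised
two-Gold-map graph state is `(4 + 2√2)·2^{-n/2}`-flat against EVERY locally rotated non-identity Pauli
string, all fields `K` of order `2ⁿ` (`n ≥ n₀`), all additive `e` (`δ := 1/4`). Route:
`⟨ĝ₂|⊗N|ĝ₂⟩ = 2^{-n} Σ_{x,x'} A(x,x') B¹(F¹x,F¹x') B²(F²x,F²x')` (`graph_dot_tensorAll_mulVec` with a value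
register of `n + n` wires); `|A(x,x⊕d)| ≤ w_A(d)`, `|Bʳ(y,y⊕t)| ≤ wʳ(t)` product weights
(`OneSided.norm_prod_entry`, `conj_apply_diag`) with `Σ_t wʳ(t)² = 1` (`sum_sq_productWeight`);
diagonal `= (∏ diag) · Σ_x (−1)^{φ x + ψ₁(x³) + ψ₂(x⁵)}`: `0` if `ψ₁ = ψ₂ = 0 ≠ φ` (`sum_sign_eq_zero`),
`≤ 2√2ⁿ` if `ψ₂ = 0 ≠ ψ₁` (`abs_walsh_cube_le`), `≤ 4√2ⁿ` if `ψ₂ ≠ 0` (`abs_walsh_gold_add_le` after writing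
`ψᵢ = Tr(bᵢ ·)`, trace form non-degenerate); off-diagonal classes `d ≠ 0`: Cauchy–Schwarz in `x` between
the two value registers with differential fibres `≤ 2` (`card_filter_cube_xor_le_two`) and `≤ 4`
(`(v+a)⁵ + v⁵ = b` has `≤ 4` roots, `GoldWalsh.fifth_add_eq`), giving `2√2 · w_A(d)`; `Σ_d w_A(d) ≤ 2^{n/2}`;
total `2^{-n}(4√2ⁿ + 2√2·√2ⁿ) ≤ 2^{-n/4}` for `n ≥ 12`. -/
theorem stub_goldFlat :
    ∃ δ : ℝ, 0 < δ ∧ ∃ n₀ : ℕ, ∀ n ≥ n₀, ∀ (K : Type) [Field K] [Fintype K], Fintype.card K = 2 ^ n →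
      ∀ e : K ≃+ (Fin n → ZMod 2),
      ∀ u : Fin (n + (n + n)) → Matrix Bool Bool ℂ, (∀ i, u i ∈ Matrix.unitaryGroup Bool ℂ) →
        ∀ S : Fin (n + (n + n)) → Pauli, S ≠ (fun _ => Pauli.I) →
          ‖star (fun w : QReg (n + (n + n)) =>
                if (fun j : Fin (n + n) => w (Fin.natAdd n j)) =
                    Fin.append
                      (fun l : Fin n => decide (e ((e.symm (fun i : Fin n => if w (Fin.castAdd (n + n) i) then 1 else 0)) ^ 3) l = 1))
                      (fun l : Fin n => decide (e ((e.symm (fun i : Fin n => if w (Fin.castAdd (n + n) i) then 1 else 0)) ^ 5) l = 1))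
                then ((Real.sqrt 2 ^ n)⁻¹ : ℂ) else 0) ⬝ᵥ
              (tensorAll (fun i => u i * (S i).mat * star (u i))).mulVec
                (fun w : QReg (n + (n + n)) =>
                if (fun j : Fin (n + n) => w (Fin.natAdd n j)) =
                    Fin.append
                      (fun l : Fin n => decide (e ((e.symm (fun i : Fin n => if w (Fin.castAdd (n + n) i) then 1 else 0)) ^ 3) l = 1))
                      (fun l : Fin n => decide (e ((e.symm (fun i : Fin n => if w (Fin.castAdd (n + n) i) then 1 else 0)) ^ 5) l = 1))
                then ((Real.sqrt 2 ^ n)⁻¹ : ℂ) else 0)‖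
            ≤ (2 : ℝ) ^ (-(δ * (n : ℝ))) := by
  sorry

namespace Registered

/-- Alias of stub R1's statement keyed by the registered stub name. -/
abbrev stub_road : Prop := RoadLFF
/-- Alias of stub R2's statement keyed by the registered stub name. -/
abbrev stub_finder : Prop := RoadLFF → UniformGapFP
/-- Alias of stub K1's statement keyed by the registered stub name. -/
abbrev stub_killComposeGen : Prop :=
  ∀ F : QCircuitFamily cliffordT, F.IsOracleFree → F.IsUniform → FamilyLocallyFlatOf F → ¬ RoadLFF
/-- Alias of stub K2's statement keyed by the registered stub name. -/
abbrev stub_goldUniform : Prop := goldFamily.IsOracleFree ∧ goldFamily.IsUniform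
/-- Alias of stub K3's statement keyed by the registered stub name. -/
abbrev stub_goldState : Prop := GoldStateAfter ∧ GoldMapEq
/-- Alias of stub K4's statement keyed by the registered stub name. -/
abbrev stub_goldBridge : Prop := GoldStateAfter → GoldMapEq → GoldLocallyFlat' → FamilyLocallyFlatOf goldFamily
/-- Alias of stub K5's statement keyed by the registered stub name. -/
abbrev stub_goldFlat : Prop := GoldLocallyFlat'

end Registered

/-! ### Kernel-checked glue -/

/-! ### Kernel-checked glue -/

/-- **The readout glue** (PROVED): if the `2/3`–`1/3` gap of every uniform oracle-free Clifford+T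
family is separated by an `FP` function then `BQP ⊆ BPP` — indeed `⊆ P` (`mem_P_of_mem_FP`), and
`P ⊆ BPP` (`P_subset_BPP_holds`). [cite: JozsaLinden2003, §2; AroraBarak2009, Def. 1.13] -/
theorem ffThesis_of_uniformGapFP (h : UniformGapFP) : FFThesis := by
  intro L hL
  obtain ⟨F, hF, hU, hacc⟩ := ClassBQP.mem_BQP_iff.1 hL
  obtain ⟨g, hg, hsep⟩ := h F hF hU
  refine P_subset_BPP_holds (mem_P_of_mem_FP hg L fun w => ⟨fun hw => ?_, fun hw => ?_⟩)
  · exact (hsep w).1 ((hacc w).1 hw)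
  · exact (hsep w).2 ((hacc w).2 hw)

/-- **The kill, composed** (PROVED modulo the kill stubs): `¬ stub_road` — the generic kill applied to the
two-Gold-map family, whose family-level flatness comes from the field-level theorem through the bridge. -/
theorem not_road_of (hU : Registered.stub_goldUniform) (hS : Registered.stub_goldState)
    (hB : Registered.stub_goldBridge) (hF : Registered.stub_goldFlat)
    (hK : Registered.stub_killComposeGen) : ¬ Registered.stub_road :=
  hK goldFamily hU.1 hU.2 (hB hS.1 hS.2 hF)

/-- **`DeqThesis_of` — the line, composed**: the two road stubs imply the crux BY NAME
(`Dequantize.DeqThesis`; the same term as `SymplecticPurity.FFThesis`, `PauliFlat.PPThesis`, …).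
Expected fate: `stub_road` dies by `not_road_of`. -/
theorem DeqThesis_of (h₁ : Registered.stub_road) (h₂ : Registered.stub_finder) :
    Summit.QuantumAdvantage.QuantumAdvantage.Theses.Dequantize.DeqThesis :=
  ffThesis_of_uniformGapFP (h₂ h₁)

/-- The same composition concluding the SymplecticPurity copy of the crux decl. -/
theorem FFThesis_of (h₁ : Registered.stub_road) (h₂ : Registered.stub_finder) :
    Summit.QuantumAdvantage.QuantumAdvantage.Theses.SymplecticPurity.FFThesis :=
  ffThesis_of_uniformGapFP (h₂ h₁)

/-- Wiring check: the registered stub theorems feed the compositions as stated (the verbatim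
restatements are definitionally the named statements). -/
example : Summit.QuantumAdvantage.QuantumAdvantage.Theses.Dequantize.DeqThesis :=
  DeqThesis_of stub_road stub_finder

example : ¬ Registered.stub_road :=
  not_road_of stub_goldUniform stub_goldState stub_goldBridge stub_goldFlat stub_killComposeGen

end Summit.QuantumAdvantage.QuantumAdvantage.Cruxes.DeqThesis.Lines.Sketch

end
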